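import Summits.ABC.ABC.Theses.YuMatveevShapeRat
import Summits.ABC.StewartYu.GenThreeFrameSpecArchW
import Summits.ABC.StewartYu.ArchG3LineSupplyS
import Summits.ABC.StewartYu.ArchG3StartSupplyS
import Summits.ABC.StewartYu.ArchG3RecordW
import Summits.ABC.StewartYu.ArchG3LinesAssemblyK
import Summits.ABC.StewartYu.ArchG3RecLinesAll
import Literature.NumberTheory.Transcendental.Nesterenko2003Prop51Holds
import HarnessLib

set_option linter.dupNamespace false

/-! # THE CRUX `ArchCoreRat` (stmt-ABC-20502, route YuMatveevShapeRat, rung A1.L), line `arch-g3-frame` — CLOSER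
(registered skeleton v5, sha 38eb5dfe, its ONE open stub `stub_recLinesArch` now discharged; registrar/lead p4 g10, cell abc-stewartyu)

`Summit.ABC.ABC.Theses.YuMatveevShapeRat.ArchCoreRat` = the archimedean Gen-3 engine over `ℚ` in SHAPE form (Matveev 2000 Cor. 2.3 /
Nesterenko 2003 Thm 2.2 with the cell's own constants): `∃ c, ∀ r a b A B, … → −(c^r·(∏ A)·log(eB)) ≤ log|Σ bᵢ log aᵢ|`.

THE LINE (one stage, Θ′ from the start): for every REDUCED pivot-weighted datum under the negated bound at the constant `c`, the frame
runs on a SATURATED, SHAPED basis `θ` (lower-triangular Hermite-reduced `U`, `0 ≤ U ≤ N`, pivot = last index = maximal weight, sorted weights),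
on the letters of the record `P : ArchG3Rec n` (`P.A = A`, `P.W = log(eB)`, `P.N = F.N`), through the D-generic schedule and the closed letter
lines, to the END at the real roots `ξ = a^{1/N}` and the pivot-weighted Kummer-free induction, against the zero estimate
`Nesterenko2003_prop51_holds`.  The SUPPLIES (the registered stub texts, `Summits/ABC/StewartYu/ArchG3LineSupplyS.lean`):

* START `∃ c₀, ∀ c ≥ c₀, ArchG3Line.StartSupplyS c` — ✓ `ArchG3Line.startSupplyS_stub` (`ArchG3StartSupplyS`; p4 on p5's lower-triangular kit and
  lp-1's `archLevelStateQ_zero_closed`);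
* LETTER LINES `∃ c₀, ∀ c ≥ c₀, ArchG3Line.LinesSupplyS c` — ✓ `ArchG3Line.linesSupplyS_far` (`ArchG3RecLinesAll`, p5 g9; seams checked by p3 g11): p5's ✓ `ArchG3Line.linesSupplyS_of_closedK_mono`
  (θ-atoms + assembly, κ := 2^{n−1} from the path bound ✓ `SatData.abs_C_le_two_pow`) on ✓ `ArchG3Rec.linesClosedK_holds` (the closed
  letter lines `LinesClosedK (2^{n−1}) c` for SORTED weights, R50′), itself assembled from the family files: far lines (F) p1 (`kstepF_holds`,
  `oddF_holds`) on p1's atoms `ArchG3RecLinesA–F/FK`, k-steps (J)(C)+smallness p4 (`kFamilies_of_far`, `ArchG3RecLinesKCoins/KPieces/KJC`,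
  κ-twins `ArchG3RecLinesCK`, U₀-domination `ArchG3RecU0`), odd steps p2 (`ArchG3RecLinesO*`), half steps p5 (`ArchG3RecLinesH*`), smallness letters p3 (`ArchG3RecLinesCS`);
* PACKS — ✓ `ArchG3Setup.archPacksHoldV_of_linesHoldV` (p5, `ArchG3LinesV`), inside the glue;
* RECORD `ArchG3Line.RecordSupply` — ✓ `ArchG3Rec.recordSupplyArch` (`ArchG3RecordW`: exits A/B p1, covolume clause (C) + numerics (N) p4/lp-1);
* END LETTERS `ArchG3Line.EndLetters` — ✓ `ArchG3Line.endLetters_holds`;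

composed by `ArchG3Line.frameArchW_of_suppliesS` (START → lines → packs → last level → `EndAt` → frame) and
`archCoreRat_of_frameW_two_le_pow` at `c := max c₀ˢ (max c₀ᴸ 2^100)`.  Theorems only; no definition, no named fact; axioms ⊆
{propext, Classical.choice, Quot.sound}.  WHAT THIS IS NOT: not abc; not an improvement of any exponent — a kernel re-derivation of the
archimedean linear-forms bound over `ℚ` in shape form with the cell's constants.

References: Yu. V. Nesterenko, LNM 1819 (2003), Thm 2.2, §3–§5; E. M. Matveev, Izv. Math. 64 (2000), Cor. 2.3, §3–§6.
-/

namespace Summit.ABC.ABC.Cruxes.ArchCoreRat.ArchG3Frame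

open Finset
open scoped Matrix
open Summit.ABC.ABC.Theses.YuMatveevShapeRat
open Literature.NumberTheory.Transcendental Literature.NumberTheory.Transcendental.GaGm
open Summit.ABC.StewartYu
open Summit.ABC.StewartYu.GenThreeFrameSpecArchW

/-- **COMPOSITION** (the registered `ArchCoreRat_of` of skeleton v5 with the stub statement inlined): the letter-lines supply above some floor
gives the crux BY NAME — START (`startSupplyS_stub`), record (`recordSupplyArch`) and END letters (`endLetters_holds`) discharged inside, packs
inside the glue `frameArchW_of_suppliesS`, frame → crux by `archCoreRat_of_frameW_two_le_pow` and the zero estimate `Nesterenko2003_prop51_holds`.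
[cite: Nesterenko2003, Thm 2.2, §3–§5; shape only] -/
theorem ArchCoreRat_of (hLines : ∃ c₀ : ℝ, ∀ c : ℝ, c₀ ≤ c → ArchG3Line.LinesSupplyS c) :
    Summit.ABC.ABC.Theses.YuMatveevShapeRat.ArchCoreRat := by
  obtain ⟨cL, hL⟩ := hLines
  obtain ⟨cS, hS⟩ : ∃ c₀ : ℝ, ∀ c : ℝ, c₀ ≤ c → ArchG3Line.StartSupplyS c := ArchG3Line.startSupplyS_stub
  have hR : ArchG3Line.RecordSupply := ArchG3Rec.recordSupplyArch
  have hE : ArchG3Line.EndLetters := ArchG3Line.endLetters_holds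
  unfold ArchCoreRat
  set c : ℝ := max cS (max cL ((2 : ℝ) ^ 100)) with hc
  have hcS : cS ≤ c := le_max_left _ _
  have hcL : cL ≤ c := le_trans (le_max_left _ _) (le_max_right _ _)
  have hc100 : (2 : ℝ) ^ 100 ≤ c := le_trans (le_max_right _ _) (le_max_right _ _)
  have hc2 : (2 : ℝ) ≤ c := le_trans (by norm_num) hc100
  refine archCoreRat_of_frameW_two_le_pow hc2 (fun _ n hn => ?_) Nesterenko2003_prop51_holds
  exact ArchG3Line.frameArchW_of_suppliesS (hS c hcS) (hL c hcL)
    (fun m hm => by obtain ⟨Y, hY⟩ := hR m hm; exact ⟨Y, fun P => hY c hc100 P⟩) hE n hn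

/-- **THE CRUX `ArchCoreRat` (stmt-ABC-20502, route YuMatveevShapeRat, rung A1.L), PROVED BY NAME** — the archimedean Gen-3 engine over
`ℚ` in shape form, from line `arch-g3-frame` (skeleton v5, every stub discharged by tree theorems) through `ArchCoreRat_of`; the last
stub `stub_recLinesArch` (`∃ c₀, ∀ c ≥ c₀, LinesSupplyS c`) is ✓ `ArchG3Line.linesSupplyS_far` (`ArchG3RecLinesAll`, p5 g9; c₀ = 2^68: the assembly `ArchG3Rec.linesClosedK_holds` of the
family files through `linesSupplyS_of_closedK_mono`).
[cite: Nesterenko2003, Thm 2.2 (p. 55); Matveev2000, Cor 2.3; shape form] -/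
theorem archCoreRat_proof : Summit.ABC.ABC.Theses.YuMatveevShapeRat.ArchCoreRat := ArchCoreRat_of ArchG3Line.linesSupplyS_far

end Summit.ABC.ABC.Cruxes.ArchCoreRat.ArchG3Frame
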